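import Literature.Topology.FourManifolds.ProjectiveTowers

/-!
# Concordances in twice-punctured `ℂℙ²`-towers and MMSW's relative adjunction inequality (Thm. 1.8), knot/cylinder case

Relative companion of `ProjectiveTowers.lean` (which vendors the ABSOLUTE adjunction inequality, MMSW 2023 Cor. 1.9, in
its knot-and-disc case `Knot.rasmussen_nonpos_of_isTowerSlice`).  C. Manolescu, M. Marengon, S. Sarkar, M. Willis,
*A generalization of Rasmussen's invariant, with applications to surfaces in some four-manifolds*, Duke Math. J. 172 (2023)
231–311 (arXiv:1910.08195) prove the absolute inequality as the special case `L₁ = ∅` of a RELATIVE one: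

> **Theorem 1.8 (= Thm. 6.11; Thm. 7.9 (i)).** *Consider a null-homologous oriented cobordism
> `Σ ⊂ Z = (#ᵗℂℙ²bar) ∖ (B⁴ ⊔ B⁴)` from a link `L₁` to a second link `L₂`.  Suppose that every component of `Σ` has a
> boundary component in `L₂`.  Then `s(L₁) − s(L₂) ≥ χ(Σ)`.*

and they use it for CYLINDERS between links in a doubly punctured `ℂℙ²bar` (Remark 6.1, proof of Thm. 7.10:
*"there is a connected cobordism `Σ` in a doubly punctured `ℂℙ²bar` from `L` to `L⁻`, with `χ(Σ) = 0`. Then, by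
Theorem 7.9, `s(L⁻) ≤ s(L)`"*).  This file vendors the case the tree can express — `r = 0`, `L₁ = K₁` and `L₂ = K₂`
KNOTS, `Σ` a cylinder (`χ = 0`) — in the relational vocabulary of `ProjectiveTowers.lean`:

* `Knot.IsConcordanceIn K₁ K₂ X e₁ e₂ F` — a smooth proper annulus in the twice-punctured charted 4-space
  `X ∖ (e₁(B̊⁴) ⊔ e₂(B̊⁴))` from `e₁ ∘ K₁ ⊂ e₁(S³)` to `e₂ ∘ K₂ ⊂ e₂(S³)`: two smooth ball charts `e₁, e₂ : ℝ⁴ ↪ X` with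
  disjoint closed unit balls, and `F : S¹ × ℝ → X` smooth, an injective immersion on `S¹ × [1, 2]`, mapping `S¹ × (1, 2)`
  off both closed balls, with `F(·, 1) = e₁ ∘ K₁` and `F(·, 2) = e₂ ∘ K₂` (the shape of `Knot.IsConcordance` — the case
  `X = ℝ⁴ ⊂ S⁴`, shell between the spheres of radius `1` and `2` — and of `Knot.IsSliceDiscIn`; as there, neatness along
  the boundary spheres is not required: a proper smooth annulus is isotopic rel boundary to a neat one).
* `Knot.IsTowerConcordant o K₁ K₂` — such an annulus exists in some `o`-tower `(P, oP)` (`IsProjectiveTower o t P oP`),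
  with `e₁` ORIENTATION PRESERVING and `e₂` ORIENTATION REVERSING from the standard `ℝ⁴` to `(P, oP)`, balls and annulus
  lying in an open `U ⊆ P` with `H₂(U; ℤ) = 0` (so that the annulus is null-homologous in `(Z, ∂Z)`:
  `H₂(U ∖ (B̊₁ ⊔ B̊₂), ∂B₁ ⊔ ∂B₂) ≅ H₂(U, B₁ ⊔ B₂) = 0` by excision and the exact sequence of the pair, and this group
  maps to `H₂(Z, ∂Z)`).  WHY OPPOSITE ORIENTATION BEHAVIOURS: `Z` is the oriented cobordism `(I × S³) # (#ᵗℂℙ²bar)` from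
  `{0} × S³` to `{1} × S³`, both copies of `S³` read with their standard orientation; in the model
  `I × S³ ≅ S⁴ ∖ (B̊_in ⊔ B̊_out)` (the shell `1 ≤ ‖y‖ ≤ 2` of `ℝ⁴ ⊂ S⁴`) the inner ball is the identity chart and the
  outer ball is the inversion chart `y ↦ 2y/‖y‖²` at `∞`, whose Jacobian determinant is negative — the two punctures of
  `Z` are balls of OPPOSITE orientation character, the incoming link sits on the orientation-preserving one, the outgoing
  link (the one every component of `Σ` must touch; automatic for a cylinder) on the orientation-reversing one.
* `Knot.RasmussenAntitoneOver o` (predicate in `o`, the CONTENT of MMSW 2023 Thm. 1.8 = Thm. 6.11 for knots and a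
  cylinder, not asserted): whenever `K₂` is tower-concordant FROM `K₁` over `o`, `s(K₂) ≤ s(K₁)`.  The printed theorem is
  `∃ o, RasmussenAntitoneOver o` (for the `o` whose `o`-towers are the printed `#ᵗℂℙ²bar`); as in
  `Knot.rasmussen_nonpos_of_isTowerSlice` an `∃ o` would make it independent of the tree's chart conventions, and here it
  would absorb BOTH conventions at once (which orientation of `ComplexProjectivePlane` is the complex one, and which
  puncture is "incoming"): requiring instead `e₁` reversing and `e₂` preserving over `o` is the same as the present
  requirement over `-o` for the reversed tower `(P, -oP)` (`IsProjectiveTower.neg`), so the two readings are exchanged by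
  `o ↦ -o`.  This file does NOT vendor the theorem as a named fact (the tree's fact-debt discipline, D-0026, reserves that to
  the debt route's planner); the sibling proof file consumes it as the hypothesis `(h : RasmussenAntitoneOver o)`.

Consequences, proved in the sibling `ProjectiveTowerConcordanceProofs.lean` from that hypothesis: the absolute inequality
`Knot.rasmussen_nonpos_of_isTowerSlice` (puncture the H-slice disc at an interior point: an annulus from the round unknot,
`s(unknot) = 0`; the puncturing itself is proved unconditionally there), hence (`ProjectiveTowersProofs.lean`) Rasmussen's
`eq_zero_of_isSmoothlySlice`; and, at height `0` (`P = S⁴`, where the `H₂` condition is empty), concordance invariance of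
`s`, `HasRasmussenInvariant.eq_of_isConcordant`.

Deliberately NOT here: links, surfaces `Σ` of higher genus / several components and `χ(Σ)` (MMSW's full Thm. 1.8), the
`#ʳ(S¹ × S²)` summands of Thm. 6.10 (`r ≥ 1`), and any proof of the inequality: the printed proof (p. 19 of the arXiv text)
removes tubular neighbourhoods of the `t` projective lines, reads the boundary pattern as the Hopf-fibre links `F_{pᵢ}(1)`,
and applies the Lee-homology cobordism inequality in `I × S³` (Thm. 1.5, Beliakova–Wehrli), the split-union formula
(Prop. 3.8) and `s(F_p(1)) = 1 − 2p` (Thm. 1.7) — all statements about the `s`-invariant of LINKS, which the tree's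
knots-only `GaussDiagram`/`LeeRasmussen` layer cannot yet express.
-/

noncomputable section

open scoped Manifold ContDiff Topology
open Set Function

namespace Literature.Topology.FourManifolds

/-- Local notation: the model space `ℝⁿ`. -/
local notation "𝔼 " n:arg => EuclideanSpace ℝ (Fin n)
/-- Local notation: `𝕊 n` is the unit sphere in `ℝⁿ⁺¹`. -/
local notation "𝕊 " n:arg => (Metric.sphere (0 : EuclideanSpace ℝ (Fin (n + 1))) 1)

namespace Knot

/-- **Concordance (smooth proper annulus) in a twice-punctured 4-space.** For knots `K₁ K₂ : S¹ ↪ S³`, a charted space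
`X` modelled on `ℝ⁴`, maps `e₁ e₂ : ℝ⁴ → X` and `F : S¹ × ℝ → X`: `IsConcordanceIn K₁ K₂ X e₁ e₂ F` says that `e₁`, `e₂`
are smooth embeddings (two smooth ball charts) whose closed unit balls `e₁(𝔻⁴)`, `e₂(𝔻⁴)` are disjoint, so that
`Z := X ∖ (e₁(B̊⁴) ⊔ e₂(B̊⁴))` is a twice-punctured `X` with boundary spheres `e₁(S³)`, `e₂(S³)`, and that `F` restricted to
the annulus `S¹ × [1, 2]` is a smooth, properly embedded annulus in `Z` from `e₁ ∘ K₁` to `e₂ ∘ K₂`: `F` is `C^∞`,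
injective and immersive on `S¹ × [1, 2]`, maps `S¹ × (1, 2)` off both closed balls, and `F(·, 1) = e₁ ∘ K₁`,
`F(·, 2) = e₂ ∘ K₂`.  For `X = S⁴ ⊃ ℝ⁴`, `e₁` the unit ball and `e₂` the ball `‖y‖ ≥ 2` about `∞` this is a concordance
in the shell `S³ × [1, 2]` in the sense of `Knot.IsConcordance`.  As in `Knot.IsSliceDiscIn`, neatness (transversality to
the boundary spheres) is not required.  A definition (predicate), the relative analogue of `Knot.IsSliceDiscIn`.
[cite: ManolescuMarengonSarkarWillis2023, §6.1 Remark 6.1 and Thm. 6.11 (cobordisms in (#ᵗℂℙ²bar) ∖ (B⁴ ⊔ B⁴))]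
[cite: FoxMilnor1966, §1] -/
def IsConcordanceIn (K₁ K₂ : Knot) (X : Type*) [TopologicalSpace X] [ChartedSpace (𝔼 4) X]
    (e₁ e₂ : 𝔼 4 → X) (F : (𝕊 1) × ℝ → X) : Prop :=
  Manifold.IsSmoothEmbedding (𝓡 4) (𝓡 4) ∞ e₁ ∧ Manifold.IsSmoothEmbedding (𝓡 4) (𝓡 4) ∞ e₂ ∧
    Disjoint (e₁ '' Metric.closedBall (0 : 𝔼 4) 1) (e₂ '' Metric.closedBall (0 : 𝔼 4) 1) ∧
    ContMDiff ((𝓡 1).prod 𝓘(ℝ, ℝ)) (𝓡 4) ∞ F ∧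
    InjOn F (univ ×ˢ Icc 1 2) ∧
    (∀ p ∈ univ ×ˢ Icc (1 : ℝ) 2, Injective (mfderiv ((𝓡 1).prod 𝓘(ℝ, ℝ)) (𝓡 4) F p)) ∧
    (∀ (x : 𝕊 1) (t : ℝ), t ∈ Ioo (1 : ℝ) 2 →
      F (x, t) ∉ e₁ '' Metric.closedBall (0 : 𝔼 4) 1 ∪ e₂ '' Metric.closedBall (0 : 𝔼 4) 1) ∧
    (∀ x : 𝕊 1, F (x, 1) = e₁ (K₁ x)) ∧
    ∀ x : 𝕊 1, F (x, 2) = e₂ (K₂ x)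

/-! ### Basic API -/

variable {K₁ K₂ : Knot} {X : Type*} [TopologicalSpace X] [ChartedSpace (𝔼 4) X] {e₁ e₂ : 𝔼 4 → X}
  {F : (𝕊 1) × ℝ → X}

/-- The first (incoming) ball chart of a concordance datum is smoothly embedded.
[cite: ManolescuMarengonSarkarWillis2023, Thm. 6.11] -/
theorem IsConcordanceIn.isSmoothEmbedding_left (h : IsConcordanceIn K₁ K₂ X e₁ e₂ F) :
    Manifold.IsSmoothEmbedding (𝓡 4) (𝓡 4) ∞ e₁ :=
  h.1

/-- The second (outgoing) ball chart of a concordance datum is smoothly embedded.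
[cite: ManolescuMarengonSarkarWillis2023, Thm. 6.11] -/
theorem IsConcordanceIn.isSmoothEmbedding_right (h : IsConcordanceIn K₁ K₂ X e₁ e₂ F) :
    Manifold.IsSmoothEmbedding (𝓡 4) (𝓡 4) ∞ e₂ :=
  h.2.1

/-- The two closed balls of a concordance datum are disjoint. [cite: ManolescuMarengonSarkarWillis2023, Thm. 6.11] -/
theorem IsConcordanceIn.disjoint (h : IsConcordanceIn K₁ K₂ X e₁ e₂ F) :
    Disjoint (e₁ '' Metric.closedBall (0 : 𝔼 4) 1) (e₂ '' Metric.closedBall (0 : 𝔼 4) 1) :=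
  h.2.2.1

/-- The annulus of a concordance datum is smooth. [cite: ManolescuMarengonSarkarWillis2023, Thm. 6.11] -/
theorem IsConcordanceIn.contMDiff (h : IsConcordanceIn K₁ K₂ X e₁ e₂ F) :
    ContMDiff ((𝓡 1).prod 𝓘(ℝ, ℝ)) (𝓡 4) ∞ F :=
  h.2.2.2.1

/-- The annulus of a concordance datum is injective on `S¹ × [1, 2]`.
[cite: ManolescuMarengonSarkarWillis2023, Thm. 6.11] -/
theorem IsConcordanceIn.injOn (h : IsConcordanceIn K₁ K₂ X e₁ e₂ F) : InjOn F (univ ×ˢ Icc 1 2) :=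
  h.2.2.2.2.1

/-- The annulus of a concordance datum is an immersion on `S¹ × [1, 2]`.
[cite: ManolescuMarengonSarkarWillis2023, Thm. 6.11] -/
theorem IsConcordanceIn.injective_mfderiv (h : IsConcordanceIn K₁ K₂ X e₁ e₂ F) {p : (𝕊 1) × ℝ}
    (hp : p ∈ univ ×ˢ Icc (1 : ℝ) 2) : Injective (mfderiv ((𝓡 1).prod 𝓘(ℝ, ℝ)) (𝓡 4) F p) :=
  h.2.2.2.2.2.1 p hp

/-- Properness: the open annulus misses both removed closed balls.
[cite: ManolescuMarengonSarkarWillis2023, Thm. 6.11] -/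
theorem IsConcordanceIn.apply_notMem (h : IsConcordanceIn K₁ K₂ X e₁ e₂ F) (x : 𝕊 1) {t : ℝ}
    (ht : t ∈ Ioo (1 : ℝ) 2) :
    F (x, t) ∉ e₁ '' Metric.closedBall (0 : 𝔼 4) 1 ∪ e₂ '' Metric.closedBall (0 : 𝔼 4) 1 :=
  h.2.2.2.2.2.2.1 x t ht

/-- The annulus starts at `e₁ ∘ K₁` on the first boundary sphere. [cite: ManolescuMarengonSarkarWillis2023, Thm. 6.11] -/
theorem IsConcordanceIn.apply_one (h : IsConcordanceIn K₁ K₂ X e₁ e₂ F) (x : 𝕊 1) : F (x, 1) = e₁ (K₁ x) :=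
  h.2.2.2.2.2.2.2.1 x

/-- The annulus ends at `e₂ ∘ K₂` on the second boundary sphere. [cite: ManolescuMarengonSarkarWillis2023, Thm. 6.11] -/
theorem IsConcordanceIn.apply_two (h : IsConcordanceIn K₁ K₂ X e₁ e₂ F) (x : 𝕊 1) : F (x, 2) = e₂ (K₂ x) :=
  h.2.2.2.2.2.2.2.2 x

/-- The first boundary circle of the annulus lies on the first boundary sphere `e₁(S³)`.
[cite: ManolescuMarengonSarkarWillis2023, Thm. 6.11] -/
theorem IsConcordanceIn.apply_one_mem (h : IsConcordanceIn K₁ K₂ X e₁ e₂ F) (x : 𝕊 1) :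
    F (x, 1) ∈ e₁ '' Metric.sphere (0 : 𝔼 4) 1 :=
  ⟨K₁ x, (K₁ x).2, (h.apply_one x).symm⟩

/-- The second boundary circle of the annulus lies on the second boundary sphere `e₂(S³)`.
[cite: ManolescuMarengonSarkarWillis2023, Thm. 6.11] -/
theorem IsConcordanceIn.apply_two_mem (h : IsConcordanceIn K₁ K₂ X e₁ e₂ F) (x : 𝕊 1) :
    F (x, 2) ∈ e₂ '' Metric.sphere (0 : 𝔼 4) 1 :=
  ⟨K₂ x, (K₂ x).2, (h.apply_two x).symm⟩

/-! ### Tower-concordance over an orientation of `ℂℙ²` -/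

/-- **Tower-concordant over `o`** (the relative analogue of `Knot.IsTowerSlice`; MMSW's null-homologous cylinders in
`(#ᵗℂℙ²bar) ∖ (B⁴ ⊔ B⁴)`, Remark 6.1 / Thm. 6.11, for knots).  `IsTowerConcordant o K₁ K₂`: for some `o`-tower `(P, oP)`
(`IsProjectiveTower o t P oP`) there is a concordance datum `IsConcordanceIn K₁ K₂ P e₁ e₂ F` — a smooth proper annulus in
`P ∖ (e₁(B̊⁴) ⊔ e₂(B̊⁴))` from `e₁ ∘ K₁` to `e₂ ∘ K₂` — whose FIRST ball chart `e₁` is orientation PRESERVING and whose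
SECOND ball chart `e₂` is orientation REVERSING from the standard `ℝ⁴` (`SmoothOrientation.euclidean 4`) to `(P, oP)` (the
two punctures of the oriented cobordism `Z : S³ → S³` have opposite orientation characters; `K₁` is the incoming and `K₂`
the outgoing knot, both read in the standard `S³`), and an open `U ⊆ P` containing `e₁(ℝ⁴)`, `e₂(ℝ⁴)` and `F(S¹ × ℝ)`
with `H₂(U; ℤ) = 0`, so that the annulus is null-homologous in `(Z, ∂Z)`.  A definition (predicate in `o`, `K₁`, `K₂`).
[cite: ManolescuMarengonSarkarWillis2023, §6.1 Remark 6.1, Def. 6.2 and Thm. 6.11] -/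
def IsTowerConcordant (o : SmoothOrientation (𝓡 4) ComplexProjectivePlane) (K₁ K₂ : Knot) : Prop :=
  ∃ (t : ℕ) (P : Type) (_ : TopologicalSpace P) (_ : T2Space P) (_ : SecondCountableTopology P)
    (_ : ChartedSpace (𝔼 4) P) (_ : IsManifold (𝓡 4) ∞ P) (_ : CompactSpace P)
    (oP : SmoothOrientation (𝓡 4) P) (e₁ e₂ : 𝔼 4 → P) (F : (𝕊 1) × ℝ → P),
    IsProjectiveTower o t P oP ∧ IsConcordanceIn K₁ K₂ P e₁ e₂ F ∧
      IsOrientationPreserving (SmoothOrientation.euclidean 4) oP e₁ ∧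
      IsOrientationReversing (SmoothOrientation.euclidean 4) oP e₂ ∧
      ∃ U : TopologicalSpace.Opens P, (∀ v, e₁ v ∈ U) ∧ (∀ v, e₂ v ∈ U) ∧ (∀ p, F p ∈ U) ∧
        CategoryTheory.Limits.IsZero (singularHomologyZ (↥U) 2)

/-- Constructor for `IsTowerConcordant` from a concordance datum in a given `o`-tower.
[cite: ManolescuMarengonSarkarWillis2023, Thm. 6.11] -/
theorem IsConcordanceIn.isTowerConcordant {o : SmoothOrientation (𝓡 4) ComplexProjectivePlane} {t : ℕ} {P : Type}
    [TopologicalSpace P] [T2Space P] [SecondCountableTopology P] [ChartedSpace (𝔼 4) P] [IsManifold (𝓡 4) ∞ P]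
    [CompactSpace P] {oP : SmoothOrientation (𝓡 4) P} {e₁ e₂ : 𝔼 4 → P} {F : (𝕊 1) × ℝ → P}
    (h : IsConcordanceIn K₁ K₂ P e₁ e₂ F) (hT : IsProjectiveTower o t P oP)
    (he₁ : IsOrientationPreserving (SmoothOrientation.euclidean 4) oP e₁)
    (he₂ : IsOrientationReversing (SmoothOrientation.euclidean 4) oP e₂)
    (U : TopologicalSpace.Opens P) (hU₁ : ∀ v, e₁ v ∈ U) (hU₂ : ∀ v, e₂ v ∈ U) (hUF : ∀ p, F p ∈ U)
    (hU : CategoryTheory.Limits.IsZero (singularHomologyZ (↥U) 2)) :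
    IsTowerConcordant o K₁ K₂ :=
  ⟨t, P, _, ‹_›, ‹_›, _, ‹_›, ‹_›, oP, e₁, e₂, F, hT, h, he₁, he₂, U, hU₁, hU₂, hUF, hU⟩

/-- **Monotonicity of `s` under tower-concordance over `o`** — the CONTENT of MMSW 2023, Thm. 1.8 (= Thm. 6.11;
Thm. 7.9 (i)) in the case `r = 0`, two KNOTS, `Σ` a CYLINDER, written as a predicate in the orientation `o` (NOT asserted
here; see the module docstring).  As printed (Thm. 6.11): "Consider a null-homologous oriented cobordism
`Σ ⊂ Z = (#ᵗℂℙ²bar) ∖ (B⁴ ⊔ B⁴)` from a link `L₁` to a second link `L₂`.  Suppose that every component of `Σ` has a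
boundary component in `L₂`.  Then, we have an inequality of `s`-invariants `s(L₁) − s(L₂) ≥ χ(Σ)`"; for a cylinder between
knots (`χ = 0`, one component, touching `L₂`; the use made of the theorem in the proof of Thm. 7.10): `s(K₂) ≤ s(K₁)`.
`RasmussenAntitoneOver o` says: whenever `K₂` is tower-concordant from `K₁` over `o` (`Knot.IsTowerConcordant o K₁ K₂`),
every Rasmussen invariant of `K₂` is at most every Rasmussen invariant of `K₁`.  The printed theorem is the assertion
`∃ o, RasmussenAntitoneOver o` (for the `o` whose `o`-towers are the printed `#ᵗℂℙ²bar`; the `∃ o` would make it independent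
of which orientation of `ComplexProjectivePlane` is the complex one AND of which puncture is called incoming — the two
readings are exchanged by `o ↦ -o`, `IsProjectiveTower.neg`).  It is consumed in this hypothesis form by the sibling
`ProjectiveTowerConcordanceProofs.lean`, which derives from it `Knot.rasmussen_nonpos_of_isTowerSlice` (Cor. 1.9, knots:
puncture the disc) and, at height `0`, `HasRasmussenInvariant.eq_of_isConcordant`.  Inputs of the printed proof not in the
tree: the Lee-homology cobordism maps and the cobordism inequality in `I × S³` (Thm. 1.5, `r = 0`: Beliakova–Wehrli;
Rasmussen 2010 §4), the split-union formula `s(L ⊔ L') = s(L) + s(L') − 1` (Prop. 3.8) and `s(F_p(1)) = 1 − 2p`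
(Thm. 1.7), all statements about LINKS.  A definition (predicate in `o`), not a named fact.
[cite: ManolescuMarengonSarkarWillis2023, Thm. 1.8, Thm. 6.11, Thm. 7.9 and proof of Thm. 7.10; Remark 6.1] -/
def RasmussenAntitoneOver (o : SmoothOrientation (𝓡 4) ComplexProjectivePlane) : Prop :=
  ∀ (K₁ K₂ : Knot), IsTowerConcordant o K₁ K₂ →
    ∀ s₁ s₂ : ℤ, K₁.HasRasmussenInvariant s₁ → K₂.HasRasmussenInvariant s₂ → s₂ ≤ s₁

end Knot

end Literature.Topology.FourManifolds

end
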